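import Mathlib.Analysis.SpecialFunctions.Pow.Real
import HarnessLib

/-!
# Connectivity correlation inequalities for `φ_{w,q}` — the hub inequality with an apex terminal and TWO terminals in the rest,
# placement `(x; t; z)`: the certificate (pure algebra) of the NONLINEAR reduction to the rest

Support file (`--supports stmt-CriticalPhenomena-4575`), census seat `prim-bschramm-census` (gen 23) of the post-continuity programme;
builds on p205010 (kernel theorem, internal audit signed; external expert review pending).  No definitions, no named facts, no sorries;
standard axioms.  Continues `…ApexHubRestAlg.lean` / `…ApexHubRest.lean` (the one-rest-terminal placements, where the defect is
`κ·(one rest hub slack) + N`).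

SETTING (how the lemma is meant to be instantiated; the measure-theoretic wrapper is NOT in this file).  `x` an apex over `(u, v)` with
leaf-type weights `n, U, V, W ≥ 0` (types: `x` isolated / joined to `u` only / to `v` only / to both), `t, z` two further vertices, `φ°` the rest
(`x`'s pairs deleted) with total mass `M` and `φ_c` the rest with `uv` CONTRACTED (`w°[uv ↦ 1]`) with total mass `Mc`; rest masses
`put = S°(u↔t)`, `pvt = S°(v↔t)`, `pzt = S°(z↔t)`, `putz = S°(u↔t↔z)`, `pvtz = S°(v↔t↔z)`, and contracted masses `cwt = S_c(w↔t)`,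
`czt = S_c(z↔t)`, `cwtz = S_c(w↔t↔z)` (`w` = the merged hub).  Peeling `x` (table lemma of `…ApexHubCyl.lean`; the doubly-attached cylinder
reads the contracted rest) gives `Z = (n+U+V)M + W·Mc`, `S(x↔t) = U·put + V·pvt + W·cwt`, `S(z↔t) = (n+U+V)·pzt + W·czt`,
`S(x↔t↔z) = U·putz + V·pvtz + W·cwtz`.  THEOREM **`apex_rest_two_alg`**: the hub inequality `S(x↔t)S(z↔t) ≤ Z·S(x↔t↔z)` at `(x; t; z)` follows
from SIX facts about the rest — the hub inequalities `Hub°(u;t;z)`, `Hub°(v;t;z)`, `Hub_c(w;t;z)` and the three contraction-monotonicity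
(edge–connection) inequalities `φ_c(z↔t) ≥ φ°(z↔t)`, `φ_c(w↔t) ≥ φ°(u↔t)`, `φ_c(w↔t) ≥ φ°(v↔t)` — through the FORMAL identity
`M·Mc·(Z·S(xtz) − S(xt)S(zt)) = M·Mc·[(n+U+V)(U·Su + V·Sv) + W²·Sc] + W·[(n+U+V)M²·Sc + U·Mc²·Su + V·Mc²·Sv + CMz·(n·M·cwt + U·CMu + V·CMv)]`
(`Su, Sv, Sc` the three hub slacks, `CMz, CMu, CMv` the three monotonicity slacks).  Census seat gen 23 showed by exact LP that NO certificate of the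
linear kind `Σ κᵢ·(rest slack) + nonneg` exists for this placement at `q < 1` (memo `FROM-census-g23-…` §B.3): the product `CMz·(…)` is essential.
[cite: AyyerLinussonRavichandran2025, §7 eq. (13)–(14) (p. 22)] [cite: Grimmett2006, Thm. (3.1)(a) (p. 37); §3.9 (p. 63)]
-/

noncomputable section

namespace Summit.CriticalPhenomena.PercolationContinuityZ3.Theorems

namespace FK

/-- **Certificate for the `(x; t; z)` reduction** (hub `t` and `z` in the rest, `x` an apex over `(u,v)`): with the table forms of
`Z, S(x↔t), S(z↔t), S(x↔t↔z)` in the leaf-type weights `n, U, V, W ≥ 0`, the rest hub slacks `Su, Sv, Sc ≥ 0` and the contraction-monotonicity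
slacks `CMz, CMu, CMv ≥ 0` give `S(x↔t)·S(z↔t) ≤ Z·S(x↔t↔z)`. [cite: AyyerLinussonRavichandran2025, §7 eq. (13) (p. 22)] -/
theorem apex_rest_two_alg {n U V W M Mc put pvt pzt putz pvtz cwt czt cwtz SA SB SAB Z : ℝ}
    (hn : 0 ≤ n) (hU : 0 ≤ U) (hV : 0 ≤ V) (hW : 0 ≤ W) (hM : 0 < M) (hMc : 0 < Mc) (hcwt : 0 ≤ cwt)
    (hSu : 0 ≤ M * putz - put * pzt) (hSv : 0 ≤ M * pvtz - pvt * pzt) (hSc : 0 ≤ Mc * cwtz - cwt * czt)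
    (hCMz : 0 ≤ M * czt - Mc * pzt) (hCMu : 0 ≤ M * cwt - Mc * put) (hCMv : 0 ≤ M * cwt - Mc * pvt)
    (hSA : SA = U * put + V * pvt + W * cwt) (hSB : SB = (n + U + V) * pzt + W * czt)
    (hSAB : SAB = U * putz + V * pvtz + W * cwtz) (hZ : Z = (n + U + V) * M + W * Mc) :
    SA * SB ≤ Z * SAB := by
  rw [← sub_nonneg]
  have key : M * Mc * (Z * SAB - SA * SB) =
      M * Mc * ((n + U + V) * (U * (M * putz - put * pzt) + V * (M * pvtz - pvt * pzt)) + W * W * (Mc * cwtz - cwt * czt)) +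
        W * ((n + U + V) * (M * M) * (Mc * cwtz - cwt * czt) + U * (Mc * Mc) * (M * putz - put * pzt) +
          V * (Mc * Mc) * (M * pvtz - pvt * pzt) +
          (M * czt - Mc * pzt) * (n * M * cwt + U * (M * cwt - Mc * put) + V * (M * cwt - Mc * pvt))) := by
    rw [hSA, hSB, hSAB, hZ]; ring
  have hMM : 0 < M * Mc := mul_pos hM hMc
  have hM0 : 0 ≤ M := hM.le
  have hMc0 : 0 ≤ Mc := hMc.le
  have hrhs : 0 ≤ M * Mc * (Z * SAB - SA * SB) := by rw [key]; positivity
  exact (mul_nonneg_iff_of_pos_left hMM).1 hrhs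

end FK

end Summit.CriticalPhenomena.PercolationContinuityZ3.Theorems

end
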